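import Literature.Barriers.Parity.SiegelZeroPrimePairsTheorem2
import Literature.Barriers.Parity.SiegelZeroGoldbachTheorem1
import Literature.NumberTheory.LFunctions.PagePNTWithExceptionalZeroProofs
import HarnessLib

/-!
# Goldston–Suriajaya, Theorem 2: the barrier `SiegelZeroPrimePairBarrier`, proved

Sibling of `Literature/Barriers/Parity/SiegelZeroPrimePairs.lean` (the catalogue entry; named
fact `Literature.Barriers.Parity.SiegelZeroPrimePairBarrier` = Goldston–Suriajaya,
*Note on the Goldbach conjecture and Landau–Siegel zeros*, arXiv:2104.09407, Theorem 2: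
"Theorem 1 holds if we replace the Weak Hardy–Littlewood Goldbach Conjecture with the
Hardy–Littlewood Prime-Pair Upper Bound Conjecture" — the conjectured bound
`ψ₂(x, k) ≤ (2 − δ)𝔖(k)(x − k) + o(𝔖(k)x)` uniformly for even `2 ≤ k ≤ x` forces
`β₁ < 1 − C(δ)/log² q` for real zeros `β₁ > 1 − c/log q` of real `L(s, χ)` mod `q`, `q` large).

The fact is now a THEOREM of the tree: `SiegelZeroPrimePairsTheorem2.lean` proves it from the
prime number theorem for progressions with the exceptional term (the source's input (PNTAP),
§4, = Montgomery–Vaughan Cor. 11.17 (11.29), the tree's named fact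
`Literature.NumberTheory.LFunctions.PagePNTWithExceptionalZero`), and
`PagePNTWithExceptionalZeroProofs.lean` proves that fact (Landau's method with a second pole,
MV Theorem 11.16, Case 2). This file records the one-line composition.

Likewise Theorem 1 itself (the named fact `Literature.Barriers.Parity.GoldstonSuriajaya2021_goldbach`:
the Weak Hardy–Littlewood Goldbach Conjecture forces the same repulsion, (A) for `χ(−1) = −1`
and (B) for `χ(−1) = 1`) is proved from the same input in `SiegelZeroGoldbachTheorem1.lean`
(power-series weights `ρ^{m+m'}`, `ρ = 1 − 1/N`, GS21 §§2–5), and composed here: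
`GoldstonSuriajaya2021_goldbach_holds`.

## References

* D. A. Goldston, A. I. Suriajaya, *Note on the Goldbach conjecture and Landau–Siegel zeros*,
  arXiv:2104.09407 (2021), Theorems 1–3, §§2–5, §7. [cite: GoldstonSuriajaya2021, Theorems 1, 2]
* H. L. Montgomery, R. C. Vaughan, *Multiplicative Number Theory I. Classical Theory*, CUP 2007,
  Theorem 11.16 and Corollary 11.17 (11.29). [cite: MontgomeryVaughan2007, Corollary 11.17]
-/

namespace Literature.Barriers.Parity

/-- **Goldston–Suriajaya 2021, Theorem 2 (the Siegel-zero obstruction to shift-uniform prime-pair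
upper bounds), PROVED**: `SiegelZeroPrimePairBarrier` holds — there is an absolute `c > 0` such
that for every `0 < δ < 1` for which the Hardy–Littlewood Prime-Pair Upper Bound Conjecture
`HLPrimePairUpperBoundConj δ` holds there are `C > 0`, `q₀` with: for `q ≥ q₀`, every real
character `χ` mod `q` and every real zero `β ∈ (1 − c/log q, 1)` of `L(s, χ)` satisfy
`β < 1 − C/log² q`. Composition of `SiegelZeroPrimePairBarrier_of_pagePNT` (the source's §§4–7)
with `Literature.NumberTheory.LFunctions.PagePNTWithExceptionalZero_holds` (its input (PNTAP)).
[cite: GoldstonSuriajaya2021, Theorem 2] -/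
theorem SiegelZeroPrimePairBarrier_holds : SiegelZeroPrimePairBarrier :=
  SiegelZeroPrimePairBarrier_of_pagePNT
    Literature.NumberTheory.LFunctions.PagePNTWithExceptionalZero_holds

/-- **Goldston–Suriajaya 2021, Theorem 1, PROVED**: `GoldstonSuriajaya2021_goldbach` holds —
there is an absolute `c > 0` such that for every `0 < δ < 1` for which the Weak Hardy–Littlewood
Goldbach Conjecture `WeakHLGoldbachConj δ` ((A) `δ𝔖(n)n ≤ ψ₂(n)` and (B)
`ψ₂(n) ≤ (2 − δ)𝔖(n)n` for large even `n`) holds there are `C > 0`, `q₀` with: for `q ≥ q₀`,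
every real character `χ` mod `q` and every real zero `β ∈ (1 − c/log q, 1)` of `L(s, χ)` satisfy
`β < 1 − C/log² q` ("if `χ(−1) = −1` then this follows from (A) …, and if `χ(−1) = 1` then this
follows from (B)"). Composition of `GoldstonSuriajaya2021_goldbach_of_pagePNT` (the source's
§§2–5 with the weight `ρ = 1 − 1/N`) with
`Literature.NumberTheory.LFunctions.PagePNTWithExceptionalZero_holds` (its input (PNTAP) =
Montgomery–Vaughan (11.29)). [cite: GoldstonSuriajaya2021, Theorem 1] -/
theorem GoldstonSuriajaya2021_goldbach_holds : GoldstonSuriajaya2021_goldbach :=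
  GoldstonSuriajaya2021_goldbach_of_pagePNT
    Literature.NumberTheory.LFunctions.PagePNTWithExceptionalZero_holds

end Literature.Barriers.Parity
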